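import Summits.QuantumFields.YangMills.Theorems.PoincareLipschitzMassRowsOfCharts
import Summits.QuantumFields.YangMills.Theorems.RenyiTelescopeTelescopedCruxR
import HarnessLib

/-!
# Crux stmt-QuantumFields-19936 `UnitScaleTilt.HistoryTailL`, K2 at depth (route crux `PoincareLipschitz.BlockLipschitzL`, stmt-QuantumFields-23533),
# F6 of the K2 supplier plan of record — file F6-ROW-LOWCHART: THE SOCKET SHRUNK TO THE LOW LEVELS
# (per-bond charts are needed only at levels where the tower's own `ℓ²` bound is not yet pointwise-small; small data and shallow depths need NONE)

Cell `ym3-torus` (YM ladder rung R3 = continuum SU(2) Yang–Mills on the three-torus — a RUNG, NOT the Clay problem: not d = 4, not infinite volume,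
not a mass gap); width seat `ym-ust-19936-w2` g11, F6 pen (LEAD `ym-ust-19936-w1` g7, 2026-08-29T02:02:59Z (4), card v1.31 «F6-ROW-CHART∕SOCKET GO»).
Helper `--supports stmt-QuantumFields-19936`; THEOREMS ONLY (0 `def`, 0 `sorry`).  Nothing here proves the charts, h⋆ at depth, `stub_iteratedLipschitz`,
`BlockLipschitzL`, `HistoryTailL` or a summit statement.

WHY.  ✓`PoincareLipschitzMassRowsOfCharts.massRows_of_charts` (this seat) reduces the knit's walk-mass rows to per-bond charts `σ_i` at EVERY level `i < j`.
But the tower already carries `Σ_{S_i[m]}‖Y_i‖² ≤ 4L^{−i}·Bx`, and `N(c) ⊆ S_i[m]` for `c ∈ S_{i+1}[m]` (✓`readingSet_closed_margin`), so at every level where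
`4L^{−i}·Bx ≤ τ²·(4∕9)^i` (`τ := (10⁸L⁷)⁻¹`) the `ℓ²` bound IS a chart: `‖Y_i(b)‖ ≤ √(4L^{−i}Bx) ≤ τ·(2∕3)^i`, summable over such levels by `3τ` whatever they
are.  Hence the supplier owes charts ONLY at the LOW levels `τ²(4∕9)^i < 4L^{−i}·Bx` — for a `T`-near pair these are the bottom
`≈ 2·((2j+1−K) + log_L(T²γp²∕τ²))₊` levels; for small data (`2√Bx ≤ τ`) and hence at every shallow depth there are NONE (`L ≥ 3 > 9∕4`), which recovers
✓`PoincareLipschitzAvgStabilitySmallData` (p686808) INSIDE the F6 chain with `cX = τ∕2`.  This file types that reduction: LOW-LEVEL CHARTS ⇒ CHARTS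
(`σ'_i := σ_i + 𝟙[level i high]·√(4L^{−i}Bx)`), hence ⇒ rows ⇒ h⋆ ⇒ `stub_iteratedLipschitz`.

WHAT IS PROVED (ns `…Theorems.PoincareLipschitzMassRowsOfLowCharts`).
* §1 `norm_le_sqrt_of_mem` (one term of an `ℓ²` sum), `sqrt_le_of_high` (`√(4L^{−i}Bx) ≤ τ(2∕3)^i` at a high level); `Σ_{i<n}(2∕3)^i ≤ 3` is ✓`RenyiTelescope.geom_sum_two_thirds`.
* §2 ★★★ `charts_of_lowCharts (hLow) : <F6-ROW-CHART's hCharts VERBATIM>`.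
* §3 ★★★ `stub_iteratedLipschitz_of_lowCharts (hLow) : <stub_iteratedLipschitz VERBATIM>`, `avgStability_star_of_lowCharts`.
HONEST SCOPE.  Bookkeeping (`ℓ² ⇒ ℓ^∞` at the high levels, a geometric sum); the low-level charts are displayed, NOT proved — they are the multiscale
Coulomb chart of the F6-SOCKET memo (inputs: ★w3 S-ALIGN, ★w5 RIESZ-LOG + covariant∕multiscale twin).  YM₃ on T³ is rung R3, not the Clay problem.

References: T. Bałaban, CMP 98 (1985) 17–51 [Balaban1985Averaging] (Props 1–3 (122)–(126) p.36, §3 (156)–(163)); CMP 96 (1984) 223–250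
[Balaban1984PropagatorsII] (§1); CMP 109 (1987) 249–301 [Balaban1987RG1] ((0.4) p.253).
-/

noncomputable section

open scoped BigOperators Matrix.Norms.L2Operator
open NormedSpace

namespace Summit.QuantumFields.YangMills.Theorems.PoincareLipschitzMassRowsOfLowCharts

open Literature.MathematicalPhysics.QuantumFieldTheory.Balaban1983to89
open Literature.MathematicalPhysics.QuantumFieldTheory.Balaban1983to89.T3ContinuumYM3Torus
open Finset T4Continuum BlockAveraging AveragingRT ExpMeanLog BlockAveragingEMLLinearised BlockAveragingEMLLinearisedBackground
open Summit.QuantumFields.YangMills.Theorems.PoincareLipschitzAvgStabilityOfMassRows (readingSet_closed_margin)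
open Summit.QuantumFields.YangMills.Theorems.PoincareLipschitzMassRowsOfCharts (massRows_of_charts avgStability_star_of_charts stub_iteratedLipschitz_of_charts)
open Summit.QuantumFields.YangMills.Theorems.RenyiTelescope (geom_sum_two_thirds)

/-! ## §1 Letters -/

/-- One term of a sum of squares: `b ∈ S`, `Σ_{S} ‖Y‖² ≤ B` ⇒ `‖Y b‖ ≤ √B`. [folklore] -/
theorem norm_le_sqrt_of_mem {ι E : Type*} [SeminormedAddCommGroup E] {S : Finset ι} {Y : ι → E} {B : ℝ} {b : ι} (hb : b ∈ S)
    (hB : ∑ b ∈ S, ‖Y b‖ ^ 2 ≤ B) : ‖Y b‖ ≤ Real.sqrt B := by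
  have h1 : ‖Y b‖ ^ 2 ≤ B := (Finset.single_le_sum (f := fun b => ‖Y b‖ ^ 2) (fun _ _ => sq_nonneg _) hb).trans hB
  rw [← Real.sqrt_sq (norm_nonneg (Y b))]
  exact Real.sqrt_le_sqrt h1

/-- At a HIGH level (`4L^{−i}Bx ≤ τ²(4∕9)^i`) the `ℓ²` bound is a chart: `√(4L^{−i}Bx) ≤ τ·(2∕3)^i` for `τ ≥ 0`. [folklore] -/
theorem sqrt_le_of_high {τ x : ℝ} (hτ : 0 ≤ τ) (i : ℕ) (hx : x ≤ τ ^ 2 * (4 / 9) ^ i) : Real.sqrt x ≤ τ * (2 / 3) ^ i := by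
  have h49 : ((4 : ℝ) / 9) ^ i = (((2 : ℝ) / 3) ^ i) ^ 2 := by rw [← pow_mul, mul_comm, pow_mul]; norm_num
  rw [h49, ← mul_pow] at hx
  exact (Real.sqrt_le_sqrt hx).trans (le_of_eq (Real.sqrt_sq (by positivity)))

/-! ## §2 Charts at every level from charts at the low levels -/

/-- ★★★ **CHARTS AT EVERY LEVEL FROM CHARTS AT THE LOW LEVELS.**  If the F6-ROW-CHART hypothesis holds in the weaker form where the per-bond chart at level
`i` is only asked when the level is LOW — `((10⁸L⁷)⁻¹)²·(4∕9)^i < 4·(L^i)⁻¹·Bx` — with the half budgets `σ_i ≤ (2·10⁷L⁴)⁻¹`, `Σ_{i<j}σ_i ≤ (2·10⁷L⁷)⁻¹`, then it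
holds as stated (`σ'_i := σ_i + 𝟙[high]·√(4L^{−i}Bx)`; at a high level every bond of `N(c) ⊆ S_i[m]` carries `≤ √(Σ_{S_i[m]}‖Y‖²) ≤ τ(2∕3)^i`, and `Σ τ(2∕3)^i ≤ 3τ`).
[cite: Balaban1985Averaging, Prop. 3 (122)-(126) p.36] -/
theorem charts_of_lowCharts
    (hLow : open Literature.MathematicalPhysics.QuantumFieldTheory.Balaban1983to89 Literature.MathematicalPhysics.QuantumFieldTheory.Balaban1983to89.T3ContinuumYM3Torus in ∀ (L : ℕ), ∃ T : ℝ, 0 < T ∧ ∀ (b₀ p₀ : ℝ), 0 < b₀ → 2 < p₀ → ∃ γ₂ : ℝ, 0 < γ₂ ∧ ∀ (F : T3Family) (γ : ℝ), F.L = L → 0 < γ → γ ≤ γ₂ → ∀ (K j : ℕ), 1 ≤ j → j + 3 ≤ K → ∀ (a : Plaq (F.P K) (j + 1)) (U U' : GaugeField (F.P K) 0 (Matrix.specialUnitaryGroup (Fin 2) ℂ)), (∀ (i : ℕ) (q : Plaq (F.P K) i), i < j + 1 → Site.tdist (fun k => ((((q.src k).val * F.L ^ i : ℕ)) : ZMod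 ((F.P K).sitesPerDir 0))) (fun k => ((((a.src k).val * F.L ^ (j + 1) : ℕ)) : ZMod ((F.P K).sitesPerDir 0))) + 64 * F.L ^ i ≤ 64 * F.L ^ (j + 1) → GaugeGroup.dist1 (GaugeField.plaqHol (Averaging.iter (fun i' => BlockAveraging.blockAvg (P := F.P K) (j := i') T3UnitLawDensityEML.ℰp) i U) q) < T3UnitScaleTilt.θBal F.L γ b₀ p₀ (K - i)) → (∀ (i : ℕ) (q : Plaq (F.P K) i), i < j + 1 → Site.tdist (fun k => ((((q.src k).val * F.L ^ i : ℕ)) : ZMod ((F.P K).sitesPerDir 0))) (fun k => ((((a.src k).val * F.L ^ (j + 1) : ℕ)) : ZMod ((F.P K).sitesPerDir 0))) + 64 * F.L ^ i ≤ 64 * F.L ^ (j + 1) → GaugeGroup.dist1 (GaugeField.plaqHol (Averaging.iter (fun i' => BlockAveraging.blockAvg (P := F.P K) (j := i') T3UnitLawDensityEML.ℰp) i U') q) < T3UnitScaleTilt.θBal F.L γ b₀ p₀ (K - i)) → (∀ k : GaugeTransf (F.P K) 0 (Matrix.specialUnitaryGroup (Fin 2) ℂ), (∑ b : PBond (F.P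 K) 0, if (∀ k, (b.src k - ((((a.src k).val * F.L ^ (j + 1) : ℕ)) : ZMod ((F.P K).sitesPerDir 0)) + ((8 * F.L ^ (j + 1) : ℕ) : ZMod ((F.P K).sitesPerDir 0))).val < 17 * F.L ^ (j + 1)) ∧ (∀ k, (b.tgt k - ((((a.src k).val * F.L ^ (j + 1) : ℕ)) : ZMod ((F.P K).sitesPerDir 0)) + ((8 * F.L ^ (j + 1) : ℕ) : ZMod ((F.P K).sitesPerDir 0))).val < 17 * F.L ^ (j + 1)) then GaugeGroup.dist1 (U b * (U' b)⁻¹) ^ 2 else 0) ≤ (∑ b : PBond (F.P K) 0, if (∀ k, (b.src k - ((((a.src k).val * F.L ^ (j + 1) : ℕ)) : ZMod ((F.P K).sitesPerDir 0)) + ((8 * F.L ^ (j + 1) : ℕ) : ZMod ((F.P K).sitesPerDir 0))).val < 17 * F.L ^ (j + 1)) ∧ (∀ k, (b.tgt k - ((((a.src k).val * F.L ^ (j + 1) : ℕ)) : ZMod ((F.P K).sitesPerDir 0)) + ((8 * F.L ^ (j + 1) : ℕ) : ZMod ((F.P K).sitesPerDir 0))).val < 17 * F.L ^ (j + 1)) then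 GaugeGroup.dist1 (U b * (GaugeField.gaugeAct k U' b)⁻¹) ^ 2 else 0)) → Real.sqrt (∑ b : PBond (F.P K) 0, if (∀ k, (b.src k - ((((a.src k).val * F.L ^ (j + 1) : ℕ)) : ZMod ((F.P K).sitesPerDir 0)) + ((8 * F.L ^ (j + 1) : ℕ) : ZMod ((F.P K).sitesPerDir 0))).val < 17 * F.L ^ (j + 1)) ∧ (∀ k, (b.tgt k - ((((a.src k).val * F.L ^ (j + 1) : ℕ)) : ZMod ((F.P K).sitesPerDir 0)) + ((8 * F.L ^ (j + 1) : ℕ) : ZMod ((F.P K).sitesPerDir 0))).val < 17 * F.L ^ (j + 1)) then GaugeGroup.dist1 (U b * (U' b)⁻¹) ^ 2 else 0) ≤ T * Real.sqrt ((F.L : ℝ) ^ (j + 1)) * T3UnitScaleTilt.θBal F.L γ b₀ p₀ (K - j) → ∃ m : ℕ → ℕ, (∀ i, m i ≤ m (i + 1)) ∧ m j ≤ F.L ^ (j + 1) ∧ ∃ σ : ℕ → ℝ, (∀ i, i < j → 0 ≤ σ i ∧ σ i ≤ 1 / (2 * 10 ^ 7 * (L : ℝ) ^ 4)) ∧ (∑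 i ∈ Finset.range j, σ i ≤ 1 / (2 * 10 ^ 7 * (L : ℝ) ^ 7)) ∧ ∀ i, i < j → ∀ h : GaugeTransf (F.P K) i (Matrix.specialUnitaryGroup (Fin 2) ℂ), (∀ k' : GaugeTransf (F.P K) i (Matrix.specialUnitaryGroup (Fin 2) ℂ), (∑ b : PBond (F.P K) i, if b ∈ Finset.univ.filter (fun b : PBond (F.P K) i => Site.tdist (fun k => ((((b.src k).val * F.L ^ i : ℕ)) : ZMod ((F.P K).sitesPerDir 0))) (fun k => ((((a.src k).val * F.L ^ (j + 1) : ℕ)) : ZMod ((F.P K).sitesPerDir 0))) + 2 * F.L ^ (i + 1) + m i ≤ 8 * F.L ^ (j + 1)) then GaugeGroup.dist1 (Averaging.iter (fun i' => BlockAveraging.blockAvg (P := F.P K) (j := i') T3UnitLawDensityEML.ℰp) i U b * (GaugeField.gaugeAct h (Averaging.iter (fun i' => BlockAveraging.blockAvg (P := F.P K) (j := i') T3UnitLawDensityEML.ℰp) i U') b)⁻¹) ^ 2 else 0) ≤ ∑ b : PBond (F.P K) i, if b ∈ Finset.univ.filter (fun b : PBond (F.P K) i => Site.tdist (fun k =>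 ((((b.src k).val * F.L ^ i : ℕ)) : ZMod ((F.P K).sitesPerDir 0))) (fun k => ((((a.src k).val * F.L ^ (j + 1) : ℕ)) : ZMod ((F.P K).sitesPerDir 0))) + 2 * F.L ^ (i + 1) + m i ≤ 8 * F.L ^ (j + 1)) then GaugeGroup.dist1 (Averaging.iter (fun i' => BlockAveraging.blockAvg (P := F.P K) (j := i') T3UnitLawDensityEML.ℰp) i U b * (GaugeField.gaugeAct k' (GaugeField.gaugeAct h (Averaging.iter (fun i' => BlockAveraging.blockAvg (P := F.P K) (j := i') T3UnitLawDensityEML.ℰp) i U')) b)⁻¹) ^ 2 else 0) → ∑ b ∈ Finset.univ.filter (fun b : PBond (F.P K) i => Site.tdist (fun k => ((((b.src k).val * F.L ^ i : ℕ)) : ZMod ((F.P K).sitesPerDir 0))) (fun k => ((((a.src k).val * F.L ^ (j + 1) : ℕ)) : ZMod ((F.P K).sitesPerDir 0))) + 2 * F.L ^ (i + 1) + m i ≤ 8 * F.L ^ (j + 1)), ‖BlockAveragingEMLLinearisedBackground.pertVar (Averaging.iter (fun i' => BlockAveraging.blockAvg (P := F.P K) (j := i') T3UnitLawDensityEML.ℰp)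 i U) (GaugeField.gaugeAct h (Averaging.iter (fun i' => BlockAveraging.blockAvg (P := F.P K) (j := i') T3UnitLawDensityEML.ℰp) i U')) b‖ ^ 2 ≤ 4 * ((F.L : ℝ) ^ i)⁻¹ * (∑ b : PBond (F.P K) 0, if (∀ k, (b.src k - ((((a.src k).val * F.L ^ (j + 1) : ℕ)) : ZMod ((F.P K).sitesPerDir 0)) + ((8 * F.L ^ (j + 1) : ℕ) : ZMod ((F.P K).sitesPerDir 0))).val < 17 * F.L ^ (j + 1)) ∧ (∀ k, (b.tgt k - ((((a.src k).val * F.L ^ (j + 1) : ℕ)) : ZMod ((F.P K).sitesPerDir 0)) + ((8 * F.L ^ (j + 1) : ℕ) : ZMod ((F.P K).sitesPerDir 0))).val < 17 * F.L ^ (j + 1)) then GaugeGroup.dist1 (U b * (U' b)⁻¹) ^ 2 else 0) → (1 / (10 ^ 8 * (L : ℝ) ^ 7)) ^ 2 * (4 / 9) ^ i < 4 * ((F.L : ℝ) ^ i)⁻¹ * (∑ b : PBond (F.P K) 0, if (∀ k, (b.src k - ((((a.src k).val * F.L ^ (j + 1) : ℕ)) : ZMod ((F.P K).sitesPerDir 0))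 + ((8 * F.L ^ (j + 1) : ℕ) : ZMod ((F.P K).sitesPerDir 0))).val < 17 * F.L ^ (j + 1)) ∧ (∀ k, (b.tgt k - ((((a.src k).val * F.L ^ (j + 1) : ℕ)) : ZMod ((F.P K).sitesPerDir 0)) + ((8 * F.L ^ (j + 1) : ℕ) : ZMod ((F.P K).sitesPerDir 0))).val < 17 * F.L ^ (j + 1)) then GaugeGroup.dist1 (U b * (U' b)⁻¹) ^ 2 else 0) → ∀ c ∈ Finset.univ.filter (fun b : PBond (F.P K) (i + 1) => Site.tdist (fun k => ((((b.src k).val * F.L ^ (i + 1) : ℕ)) : ZMod ((F.P K).sitesPerDir 0))) (fun k => ((((a.src k).val * F.L ^ (j + 1) : ℕ)) : ZMod ((F.P K).sitesPerDir 0))) + 2 * F.L ^ (i + 1 + 1) + m (i + 1) ≤ 8 * F.L ^ (j + 1)), ∀ b ∈ Finset.univ.filter (fun b : PBond (F.P K) i => blockOf b.src = c.src ∨ blockOf b.src = c.tgt), ‖BlockAveragingEMLLinearisedBackground.pertVar (Averaging.iter (fun i' => BlockAveraging.blockAvg (P := F.P K) (j := i') T3UnitLawDensityEML.ℰp) i U)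 (GaugeField.gaugeAct h (Averaging.iter (fun i' => BlockAveraging.blockAvg (P := F.P K) (j := i') T3UnitLawDensityEML.ℰp) i U')) b‖ ≤ σ i) :
    open Literature.MathematicalPhysics.QuantumFieldTheory.Balaban1983to89 Literature.MathematicalPhysics.QuantumFieldTheory.Balaban1983to89.T3ContinuumYM3Torus in ∀ (L : ℕ), ∃ T : ℝ, 0 < T ∧ ∀ (b₀ p₀ : ℝ), 0 < b₀ → 2 < p₀ → ∃ γ₂ : ℝ, 0 < γ₂ ∧ ∀ (F : T3Family) (γ : ℝ), F.L = L → 0 < γ → γ ≤ γ₂ → ∀ (K j : ℕ), 1 ≤ j → j + 3 ≤ K → ∀ (a : Plaq (F.P K) (j + 1)) (U U' : GaugeField (F.P K) 0 (Matrix.specialUnitaryGroup (Fin 2) ℂ)), (∀ (i : ℕ) (q : Plaq (F.P K) i), i < j + 1 → Site.tdist (fun k => ((((q.src k).val * F.L ^ i : ℕ)) : ZMod ((F.P K).sitesPerDir 0))) (fun k => ((((a.src k).val * F.L ^ (j + 1) : ℕ)) : ZMod ((F.P K).sitesPerDir 0))) + 64 * F.L ^ i ≤ 64 * F.L ^ (j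 + 1) → GaugeGroup.dist1 (GaugeField.plaqHol (Averaging.iter (fun i' => BlockAveraging.blockAvg (P := F.P K) (j := i') T3UnitLawDensityEML.ℰp) i U) q) < T3UnitScaleTilt.θBal F.L γ b₀ p₀ (K - i)) → (∀ (i : ℕ) (q : Plaq (F.P K) i), i < j + 1 → Site.tdist (fun k => ((((q.src k).val * F.L ^ i : ℕ)) : ZMod ((F.P K).sitesPerDir 0))) (fun k => ((((a.src k).val * F.L ^ (j + 1) : ℕ)) : ZMod ((F.P K).sitesPerDir 0))) + 64 * F.L ^ i ≤ 64 * F.L ^ (j + 1) → GaugeGroup.dist1 (GaugeField.plaqHol (Averaging.iter (fun i' => BlockAveraging.blockAvg (P := F.P K) (j := i') T3UnitLawDensityEML.ℰp) i U') q) < T3UnitScaleTilt.θBal F.L γ b₀ p₀ (K - i)) → (∀ k : GaugeTransf (F.P K) 0 (Matrix.specialUnitaryGroup (Fin 2) ℂ), (∑ b : PBond (F.P K) 0, if (∀ k, (b.src k - ((((a.src k).val * F.L ^ (j + 1) : ℕ)) : ZMod ((F.P K).sitesPerDir 0)) + ((8 * F.L ^ (j + 1) : ℕ) : ZMod ((F.P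 K).sitesPerDir 0))).val < 17 * F.L ^ (j + 1)) ∧ (∀ k, (b.tgt k - ((((a.src k).val * F.L ^ (j + 1) : ℕ)) : ZMod ((F.P K).sitesPerDir 0)) + ((8 * F.L ^ (j + 1) : ℕ) : ZMod ((F.P K).sitesPerDir 0))).val < 17 * F.L ^ (j + 1)) then GaugeGroup.dist1 (U b * (U' b)⁻¹) ^ 2 else 0) ≤ (∑ b : PBond (F.P K) 0, if (∀ k, (b.src k - ((((a.src k).val * F.L ^ (j + 1) : ℕ)) : ZMod ((F.P K).sitesPerDir 0)) + ((8 * F.L ^ (j + 1) : ℕ) : ZMod ((F.P K).sitesPerDir 0))).val < 17 * F.L ^ (j + 1)) ∧ (∀ k, (b.tgt k - ((((a.src k).val * F.L ^ (j + 1) : ℕ)) : ZMod ((F.P K).sitesPerDir 0)) + ((8 * F.L ^ (j + 1) : ℕ) : ZMod ((F.P K).sitesPerDir 0))).val < 17 * F.L ^ (j + 1)) then GaugeGroup.dist1 (U b * (GaugeField.gaugeAct k U' b)⁻¹) ^ 2 else 0)) → Real.sqrt (∑ b : PBond (F.P K) 0, if (∀ k, (b.src k - ((((a.src k).val * F.L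 ^ (j + 1) : ℕ)) : ZMod ((F.P K).sitesPerDir 0)) + ((8 * F.L ^ (j + 1) : ℕ) : ZMod ((F.P K).sitesPerDir 0))).val < 17 * F.L ^ (j + 1)) ∧ (∀ k, (b.tgt k - ((((a.src k).val * F.L ^ (j + 1) : ℕ)) : ZMod ((F.P K).sitesPerDir 0)) + ((8 * F.L ^ (j + 1) : ℕ) : ZMod ((F.P K).sitesPerDir 0))).val < 17 * F.L ^ (j + 1)) then GaugeGroup.dist1 (U b * (U' b)⁻¹) ^ 2 else 0) ≤ T * Real.sqrt ((F.L : ℝ) ^ (j + 1)) * T3UnitScaleTilt.θBal F.L γ b₀ p₀ (K - j) → ∃ m : ℕ → ℕ, (∀ i, m i ≤ m (i + 1)) ∧ m j ≤ F.L ^ (j + 1) ∧ ∃ σ : ℕ → ℝ, (∀ i, i < j → 0 ≤ σ i ∧ σ i ≤ 1 / (10 ^ 7 * (L : ℝ) ^ 4)) ∧ (∑ i ∈ Finset.range j, σ i ≤ 1 / (10 ^ 7 * (L : ℝ) ^ 7)) ∧ ∀ i, i < j → ∀ h : GaugeTransf (F.P K) i (Matrix.specialUnitaryGroup (Fin 2)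 ℂ), (∀ k' : GaugeTransf (F.P K) i (Matrix.specialUnitaryGroup (Fin 2) ℂ), (∑ b : PBond (F.P K) i, if b ∈ Finset.univ.filter (fun b : PBond (F.P K) i => Site.tdist (fun k => ((((b.src k).val * F.L ^ i : ℕ)) : ZMod ((F.P K).sitesPerDir 0))) (fun k => ((((a.src k).val * F.L ^ (j + 1) : ℕ)) : ZMod ((F.P K).sitesPerDir 0))) + 2 * F.L ^ (i + 1) + m i ≤ 8 * F.L ^ (j + 1)) then GaugeGroup.dist1 (Averaging.iter (fun i' => BlockAveraging.blockAvg (P := F.P K) (j := i') T3UnitLawDensityEML.ℰp) i U b * (GaugeField.gaugeAct h (Averaging.iter (fun i' => BlockAveraging.blockAvg (P := F.P K) (j := i') T3UnitLawDensityEML.ℰp) i U') b)⁻¹) ^ 2 else 0) ≤ ∑ b : PBond (F.P K) i, if b ∈ Finset.univ.filter (fun b : PBond (F.P K) i => Site.tdist (fun k => ((((b.src k).val * F.L ^ i : ℕ)) : ZMod ((F.P K).sitesPerDir 0))) (fun k => ((((a.src k).val * F.L ^ (j + 1) : ℕ)) : ZMod ((F.P K).sitesPerDir 0))) + 2 * F.L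 ^ (i + 1) + m i ≤ 8 * F.L ^ (j + 1)) then GaugeGroup.dist1 (Averaging.iter (fun i' => BlockAveraging.blockAvg (P := F.P K) (j := i') T3UnitLawDensityEML.ℰp) i U b * (GaugeField.gaugeAct k' (GaugeField.gaugeAct h (Averaging.iter (fun i' => BlockAveraging.blockAvg (P := F.P K) (j := i') T3UnitLawDensityEML.ℰp) i U')) b)⁻¹) ^ 2 else 0) → ∑ b ∈ Finset.univ.filter (fun b : PBond (F.P K) i => Site.tdist (fun k => ((((b.src k).val * F.L ^ i : ℕ)) : ZMod ((F.P K).sitesPerDir 0))) (fun k => ((((a.src k).val * F.L ^ (j + 1) : ℕ)) : ZMod ((F.P K).sitesPerDir 0))) + 2 * F.L ^ (i + 1) + m i ≤ 8 * F.L ^ (j + 1)), ‖BlockAveragingEMLLinearisedBackground.pertVar (Averaging.iter (fun i' => BlockAveraging.blockAvg (P := F.P K) (j := i') T3UnitLawDensityEML.ℰp) i U) (GaugeField.gaugeAct h (Averaging.iter (fun i' => BlockAveraging.blockAvg (P := F.P K) (j := i') T3UnitLawDensityEML.ℰp) i U')) b‖ ^ 2 ≤ 4 * ((F.L : ℝ)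 ^ i)⁻¹ * (∑ b : PBond (F.P K) 0, if (∀ k, (b.src k - ((((a.src k).val * F.L ^ (j + 1) : ℕ)) : ZMod ((F.P K).sitesPerDir 0)) + ((8 * F.L ^ (j + 1) : ℕ) : ZMod ((F.P K).sitesPerDir 0))).val < 17 * F.L ^ (j + 1)) ∧ (∀ k, (b.tgt k - ((((a.src k).val * F.L ^ (j + 1) : ℕ)) : ZMod ((F.P K).sitesPerDir 0)) + ((8 * F.L ^ (j + 1) : ℕ) : ZMod ((F.P K).sitesPerDir 0))).val < 17 * F.L ^ (j + 1)) then GaugeGroup.dist1 (U b * (U' b)⁻¹) ^ 2 else 0) → ∀ c ∈ Finset.univ.filter (fun b : PBond (F.P K) (i + 1) => Site.tdist (fun k => ((((b.src k).val * F.L ^ (i + 1) : ℕ)) : ZMod ((F.P K).sitesPerDir 0))) (fun k => ((((a.src k).val * F.L ^ (j + 1) : ℕ)) : ZMod ((F.P K).sitesPerDir 0))) + 2 * F.L ^ (i + 1 + 1) + m (i + 1) ≤ 8 * F.L ^ (j + 1)), ∀ b ∈ Finset.univ.filter (fun b : PBond (F.P K) i => blockOf b.src = c.src ∨ blockOf b.src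 = c.tgt), ‖BlockAveragingEMLLinearisedBackground.pertVar (Averaging.iter (fun i' => BlockAveraging.blockAvg (P := F.P K) (j := i') T3UnitLawDensityEML.ℰp) i U) (GaugeField.gaugeAct h (Averaging.iter (fun i' => BlockAveraging.blockAvg (P := F.P K) (j := i') T3UnitLawDensityEML.ℰp) i U')) b‖ ≤ σ i := by
  intro L
  obtain ⟨T, hT, HC⟩ := hLow L
  refine ⟨T, hT, ?_⟩
  intro b₀ p₀ hb hp
  obtain ⟨γ₂, hγ₂, HC'⟩ := HC b₀ p₀ hb hp
  refine ⟨γ₂, hγ₂, ?_⟩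
  intro F γ hFL hγ hγle K j hj1 hjK a U U' hU hU' hmin0 hnear
  obtain ⟨m, hmono, hmj, σ, hσB, hσS, hCh⟩ := HC' F γ hFL hγ hγle K j hj1 hjK a U U' hU hU' hmin0 hnear
  have hL3 : 3 ≤ F.L := (by obtain ⟨k, hk⟩ := F.hL.1; have := F.hL.2; omega)
  have hLr : (3 : ℝ) ≤ (L : ℝ) := by rw [← hFL]; exact_mod_cast hL3
  have hLpos : (0 : ℝ) < (L : ℝ) := by linarith
  have hm := F.hm
  -- the box sum is nonnegative
  obtain ⟨Bx, hBx⟩ : ∃ Bx : ℝ, Bx = ∑ b : PBond (F.P K) 0, if (∀ k, (b.src k - ((((a.src k).val * F.L ^ (j + 1) : ℕ)) : ZMod ((F.P K).sitesPerDir 0)) + ((8 * F.L ^ (j + 1) : ℕ) : ZMod ((F.P K).sitesPerDir 0))).val < 17 * F.L ^ (j + 1)) ∧ (∀ k, (b.tgt k - ((((a.src k).val * F.L ^ (j + 1) : ℕ)) : ZMod ((F.P K).sitesPerDir 0)) + ((8 * F.L ^ (j + 1) : ℕ) : ZMod ((F.P K).sitesPerDir 0))).val < 17 * F.L ^ (j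 + 1)) then GaugeGroup.dist1 (U b * (U' b)⁻¹) ^ 2 else 0 := ⟨_, rfl⟩
  rw [← hBx] at hCh ⊢
  set τ : ℝ := 1 / (10 ^ 8 * (L : ℝ) ^ 7) with hτ
  have hτ0 : 0 ≤ τ := by positivity
  -- the padded schedule
  refine ⟨m, hmono, hmj, fun i => σ i + (if τ ^ 2 * (4 / 9) ^ i < 4 * ((F.L : ℝ) ^ i)⁻¹ * Bx then 0 else Real.sqrt (4 * ((F.L : ℝ) ^ i)⁻¹ * Bx)),
    fun i hi => ⟨?_, ?_⟩, ?_, ?_⟩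
  · have := (hσB i hi).1; positivity
  · -- per-level cap: `σ_i ≤ (2·10⁷L⁴)⁻¹` and the pad `≤ τ ≤ (2·10⁷L⁴)⁻¹`
    have hpad : (if τ ^ 2 * (4 / 9) ^ i < 4 * ((F.L : ℝ) ^ i)⁻¹ * Bx then 0 else Real.sqrt (4 * ((F.L : ℝ) ^ i)⁻¹ * Bx)) ≤ τ := by
      split_ifs with hlow
      · exact hτ0
      · exact (sqrt_le_of_high hτ0 i (not_lt.mp hlow)).trans (mul_le_of_le_one_right hτ0 (pow_le_one₀ (by norm_num) (by norm_num)))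
    have hτcap : τ ≤ 1 / (2 * 10 ^ 7 * (L : ℝ) ^ 4) := by
      rw [hτ, div_le_div_iff₀ (by positivity) (by positivity)]
      have hL4 : (L : ℝ) ^ 4 ≤ (L : ℝ) ^ 7 := pow_le_pow_right₀ (by linarith) (by norm_num)
      nlinarith [pow_pos hLpos 4]
    have := (hσB i hi).2
    calc σ i + _ ≤ 1 / (2 * 10 ^ 7 * (L : ℝ) ^ 4) + 1 / (2 * 10 ^ 7 * (L : ℝ) ^ 4) := add_le_add this (hpad.trans hτcap)
      _ = 1 / (10 ^ 7 * (L : ℝ) ^ 4) := by ring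
  · -- total: `Σσ ≤ (2·10⁷L⁷)⁻¹`, `Σ pad ≤ 3τ`, and `(2·10⁷L⁷)⁻¹ + 3τ ≤ (10⁷L⁷)⁻¹`
    rw [Finset.sum_add_distrib]
    have hpadsum : ∑ i ∈ Finset.range j, (if τ ^ 2 * (4 / 9) ^ i < 4 * ((F.L : ℝ) ^ i)⁻¹ * Bx then 0 else Real.sqrt (4 * ((F.L : ℝ) ^ i)⁻¹ * Bx))
        ≤ τ * 3 := by
      calc _ ≤ ∑ i ∈ Finset.range j, τ * ((2 : ℝ) / 3) ^ i := by
            refine Finset.sum_le_sum fun i _ => ?_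
            split_ifs with hlow
            · positivity
            · exact sqrt_le_of_high hτ0 i (not_lt.mp hlow)
        _ = τ * ∑ i ∈ Finset.range j, ((2 : ℝ) / 3) ^ i := by rw [Finset.mul_sum]
        _ ≤ τ * 3 := mul_le_mul_of_nonneg_left (geom_sum_two_thirds j) hτ0
    have hkey : 1 / (2 * 10 ^ 7 * (L : ℝ) ^ 7) + τ * 3 ≤ 1 / (10 ^ 7 * (L : ℝ) ^ 7) := by
      rw [hτ]
      have h7 : 0 < (L : ℝ) ^ 7 := pow_pos hLpos 7
      rw [show 1 / (2 * 10 ^ 7 * (L : ℝ) ^ 7) + 1 / (10 ^ 8 * (L : ℝ) ^ 7) * 3 = (1 / (2 * 10 ^ 7) + 3 / 10 ^ 8) * ((L : ℝ) ^ 7)⁻¹ by ring,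
        show 1 / (10 ^ 7 * (L : ℝ) ^ 7) = (1 / 10 ^ 7) * ((L : ℝ) ^ 7)⁻¹ by ring]
      exact mul_le_mul_of_nonneg_right (by norm_num) (inv_nonneg.2 h7.le)
    exact (add_le_add hσS hpadsum).trans hkey
  · -- the chart at every level
    intro i hi h hmin hsq c hc b hbN
    by_cases hlow : τ ^ 2 * (4 / 9) ^ i < 4 * ((F.L : ℝ) ^ i)⁻¹ * Bx
    · -- low level: the displayed chart, the pad is `0`
      have key := hCh i hi h hmin hsq (by simpa only [hτ] using hlow) c hc b hbN
      simp only [hlow, ↓reduceIte, add_zero]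
      exact key
    · -- high level: the `ℓ²` bound at the bond `b ∈ N(c) ⊆ S_i[m]`
      simp only [hlow, ↓reduceIte]
      have hbS : b ∈ Finset.univ.filter (fun b : PBond (F.P K) i => Site.tdist (fun k => ((((b.src k).val * F.L ^ i : ℕ)) : ZMod ((F.P K).sitesPerDir 0))) (fun k => ((((a.src k).val * F.L ^ (j + 1) : ℕ)) : ZMod ((F.P K).sitesPerDir 0))) + 2 * F.L ^ (i + 1) + m i ≤ 8 * F.L ^ (j + 1)) := by
        rw [Finset.mem_filter] at hc hbN ⊢
        refine ⟨Finset.mem_univ _, readingSet_closed_margin F K (by omega) a.src (hmono i) c.src c.dir hc.2 b.src ?_⟩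
        rcases hbN.2 with h' | h'
        · exact Or.inr (Or.inl h')
        · exact Or.inr (Or.inr h')
      have h1 := norm_le_sqrt_of_mem hbS hsq
      have := (hσB i hi).1
      linarith

/-! ## §3 h⋆ and the registered stub from the low-level charts -/

/-- ★★★ **hStab⋆'s ROW FROM THE LOW-LEVEL CHARTS** (§2 ∘ ✓`avgStability_star_of_charts`). [cite: Balaban1985Averaging, Props 1-3 (122)-(126) p.36] -/
theorem avgStability_star_of_lowCharts
    (hLow : open Literature.MathematicalPhysics.QuantumFieldTheory.Balaban1983to89 Literature.MathematicalPhysics.QuantumFieldTheory.Balaban1983to89.T3ContinuumYM3Torus in ∀ (L : ℕ), ∃ T : ℝ, 0 < T ∧ ∀ (b₀ p₀ : ℝ), 0 < b₀ → 2 < p₀ → ∃ γ₂ : ℝ, 0 < γ₂ ∧ ∀ (F : T3Family) (γ : ℝ), F.L = L → 0 < γ → γ ≤ γ₂ → ∀ (K j : ℕ), 1 ≤ j → j + 3 ≤ K → ∀ (a : Plaq (F.P K) (j + 1)) (U U' : GaugeField (F.P K) 0 (Matrix.specialUnitaryGroup (Fin 2) ℂ)), (∀ (i : ℕ) (q : Plaq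 (F.P K) i), i < j + 1 → Site.tdist (fun k => ((((q.src k).val * F.L ^ i : ℕ)) : ZMod ((F.P K).sitesPerDir 0))) (fun k => ((((a.src k).val * F.L ^ (j + 1) : ℕ)) : ZMod ((F.P K).sitesPerDir 0))) + 64 * F.L ^ i ≤ 64 * F.L ^ (j + 1) → GaugeGroup.dist1 (GaugeField.plaqHol (Averaging.iter (fun i' => BlockAveraging.blockAvg (P := F.P K) (j := i') T3UnitLawDensityEML.ℰp) i U) q) < T3UnitScaleTilt.θBal F.L γ b₀ p₀ (K - i)) → (∀ (i : ℕ) (q : Plaq (F.P K) i), i < j + 1 → Site.tdist (fun k => ((((q.src k).val * F.L ^ i : ℕ)) : ZMod ((F.P K).sitesPerDir 0))) (fun k => ((((a.src k).val * F.L ^ (j + 1) : ℕ)) : ZMod ((F.P K).sitesPerDir 0))) + 64 * F.L ^ i ≤ 64 * F.L ^ (j + 1) → GaugeGroup.dist1 (GaugeField.plaqHol (Averaging.iter (fun i' => BlockAveraging.blockAvg (P := F.P K) (j := i') T3UnitLawDensityEML.ℰp) i U') q) < T3UnitScaleTilt.θBal F.L γ b₀ p₀ (K - i)) → (∀ k :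 GaugeTransf (F.P K) 0 (Matrix.specialUnitaryGroup (Fin 2) ℂ), (∑ b : PBond (F.P K) 0, if (∀ k, (b.src k - ((((a.src k).val * F.L ^ (j + 1) : ℕ)) : ZMod ((F.P K).sitesPerDir 0)) + ((8 * F.L ^ (j + 1) : ℕ) : ZMod ((F.P K).sitesPerDir 0))).val < 17 * F.L ^ (j + 1)) ∧ (∀ k, (b.tgt k - ((((a.src k).val * F.L ^ (j + 1) : ℕ)) : ZMod ((F.P K).sitesPerDir 0)) + ((8 * F.L ^ (j + 1) : ℕ) : ZMod ((F.P K).sitesPerDir 0))).val < 17 * F.L ^ (j + 1)) then GaugeGroup.dist1 (U b * (U' b)⁻¹) ^ 2 else 0) ≤ (∑ b : PBond (F.P K) 0, if (∀ k, (b.src k - ((((a.src k).val * F.L ^ (j + 1) : ℕ)) : ZMod ((F.P K).sitesPerDir 0)) + ((8 * F.L ^ (j + 1) : ℕ) : ZMod ((F.P K).sitesPerDir 0))).val < 17 * F.L ^ (j + 1)) ∧ (∀ k, (b.tgt k - ((((a.src k).val * F.L ^ (j + 1) : ℕ)) : ZMod ((F.P K).sitesPerDir 0)) + ((8 * F.L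 ^ (j + 1) : ℕ) : ZMod ((F.P K).sitesPerDir 0))).val < 17 * F.L ^ (j + 1)) then GaugeGroup.dist1 (U b * (GaugeField.gaugeAct k U' b)⁻¹) ^ 2 else 0)) → Real.sqrt (∑ b : PBond (F.P K) 0, if (∀ k, (b.src k - ((((a.src k).val * F.L ^ (j + 1) : ℕ)) : ZMod ((F.P K).sitesPerDir 0)) + ((8 * F.L ^ (j + 1) : ℕ) : ZMod ((F.P K).sitesPerDir 0))).val < 17 * F.L ^ (j + 1)) ∧ (∀ k, (b.tgt k - ((((a.src k).val * F.L ^ (j + 1) : ℕ)) : ZMod ((F.P K).sitesPerDir 0)) + ((8 * F.L ^ (j + 1) : ℕ) : ZMod ((F.P K).sitesPerDir 0))).val < 17 * F.L ^ (j + 1)) then GaugeGroup.dist1 (U b * (U' b)⁻¹) ^ 2 else 0) ≤ T * Real.sqrt ((F.L : ℝ) ^ (j + 1)) * T3UnitScaleTilt.θBal F.L γ b₀ p₀ (K - j) → ∃ m : ℕ → ℕ, (∀ i, m i ≤ m (i + 1)) ∧ m j ≤ F.L ^ (j + 1) ∧ ∃ σ : ℕ → ℝ, (∀ i, i < j → 0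 ≤ σ i ∧ σ i ≤ 1 / (2 * 10 ^ 7 * (L : ℝ) ^ 4)) ∧ (∑ i ∈ Finset.range j, σ i ≤ 1 / (2 * 10 ^ 7 * (L : ℝ) ^ 7)) ∧ ∀ i, i < j → ∀ h : GaugeTransf (F.P K) i (Matrix.specialUnitaryGroup (Fin 2) ℂ), (∀ k' : GaugeTransf (F.P K) i (Matrix.specialUnitaryGroup (Fin 2) ℂ), (∑ b : PBond (F.P K) i, if b ∈ Finset.univ.filter (fun b : PBond (F.P K) i => Site.tdist (fun k => ((((b.src k).val * F.L ^ i : ℕ)) : ZMod ((F.P K).sitesPerDir 0))) (fun k => ((((a.src k).val * F.L ^ (j + 1) : ℕ)) : ZMod ((F.P K).sitesPerDir 0))) + 2 * F.L ^ (i + 1) + m i ≤ 8 * F.L ^ (j + 1)) then GaugeGroup.dist1 (Averaging.iter (fun i' => BlockAveraging.blockAvg (P := F.P K) (j := i') T3UnitLawDensityEML.ℰp) i U b * (GaugeField.gaugeAct h (Averaging.iter (fun i' => BlockAveraging.blockAvg (P := F.P K) (j := i') T3UnitLawDensityEML.ℰp) i U') b)⁻¹) ^ 2 else 0) ≤ ∑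 b : PBond (F.P K) i, if b ∈ Finset.univ.filter (fun b : PBond (F.P K) i => Site.tdist (fun k => ((((b.src k).val * F.L ^ i : ℕ)) : ZMod ((F.P K).sitesPerDir 0))) (fun k => ((((a.src k).val * F.L ^ (j + 1) : ℕ)) : ZMod ((F.P K).sitesPerDir 0))) + 2 * F.L ^ (i + 1) + m i ≤ 8 * F.L ^ (j + 1)) then GaugeGroup.dist1 (Averaging.iter (fun i' => BlockAveraging.blockAvg (P := F.P K) (j := i') T3UnitLawDensityEML.ℰp) i U b * (GaugeField.gaugeAct k' (GaugeField.gaugeAct h (Averaging.iter (fun i' => BlockAveraging.blockAvg (P := F.P K) (j := i') T3UnitLawDensityEML.ℰp) i U')) b)⁻¹) ^ 2 else 0) → ∑ b ∈ Finset.univ.filter (fun b : PBond (F.P K) i => Site.tdist (fun k => ((((b.src k).val * F.L ^ i : ℕ)) : ZMod ((F.P K).sitesPerDir 0))) (fun k => ((((a.src k).val * F.L ^ (j + 1) : ℕ)) : ZMod ((F.P K).sitesPerDir 0))) + 2 * F.L ^ (i + 1) + m i ≤ 8 * F.L ^ (j + 1)), ‖BlockAveragingEMLLinearisedBackground.pertVar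 (Averaging.iter (fun i' => BlockAveraging.blockAvg (P := F.P K) (j := i') T3UnitLawDensityEML.ℰp) i U) (GaugeField.gaugeAct h (Averaging.iter (fun i' => BlockAveraging.blockAvg (P := F.P K) (j := i') T3UnitLawDensityEML.ℰp) i U')) b‖ ^ 2 ≤ 4 * ((F.L : ℝ) ^ i)⁻¹ * (∑ b : PBond (F.P K) 0, if (∀ k, (b.src k - ((((a.src k).val * F.L ^ (j + 1) : ℕ)) : ZMod ((F.P K).sitesPerDir 0)) + ((8 * F.L ^ (j + 1) : ℕ) : ZMod ((F.P K).sitesPerDir 0))).val < 17 * F.L ^ (j + 1)) ∧ (∀ k, (b.tgt k - ((((a.src k).val * F.L ^ (j + 1) : ℕ)) : ZMod ((F.P K).sitesPerDir 0)) + ((8 * F.L ^ (j + 1) : ℕ) : ZMod ((F.P K).sitesPerDir 0))).val < 17 * F.L ^ (j + 1)) then GaugeGroup.dist1 (U b * (U' b)⁻¹) ^ 2 else 0) → (1 / (10 ^ 8 * (L : ℝ) ^ 7)) ^ 2 * (4 / 9) ^ i < 4 * ((F.L : ℝ) ^ i)⁻¹ * (∑ b : PBond (F.P K) 0, if (∀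 k, (b.src k - ((((a.src k).val * F.L ^ (j + 1) : ℕ)) : ZMod ((F.P K).sitesPerDir 0)) + ((8 * F.L ^ (j + 1) : ℕ) : ZMod ((F.P K).sitesPerDir 0))).val < 17 * F.L ^ (j + 1)) ∧ (∀ k, (b.tgt k - ((((a.src k).val * F.L ^ (j + 1) : ℕ)) : ZMod ((F.P K).sitesPerDir 0)) + ((8 * F.L ^ (j + 1) : ℕ) : ZMod ((F.P K).sitesPerDir 0))).val < 17 * F.L ^ (j + 1)) then GaugeGroup.dist1 (U b * (U' b)⁻¹) ^ 2 else 0) → ∀ c ∈ Finset.univ.filter (fun b : PBond (F.P K) (i + 1) => Site.tdist (fun k => ((((b.src k).val * F.L ^ (i + 1) : ℕ)) : ZMod ((F.P K).sitesPerDir 0))) (fun k => ((((a.src k).val * F.L ^ (j + 1) : ℕ)) : ZMod ((F.P K).sitesPerDir 0))) + 2 * F.L ^ (i + 1 + 1) + m (i + 1) ≤ 8 * F.L ^ (j + 1)), ∀ b ∈ Finset.univ.filter (fun b : PBond (F.P K) i => blockOf b.src = c.src ∨ blockOf b.src = c.tgt), ‖BlockAveragingEMLLinearisedBackground.pertVar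 (Averaging.iter (fun i' => BlockAveraging.blockAvg (P := F.P K) (j := i') T3UnitLawDensityEML.ℰp) i U) (GaugeField.gaugeAct h (Averaging.iter (fun i' => BlockAveraging.blockAvg (P := F.P K) (j := i') T3UnitLawDensityEML.ℰp) i U')) b‖ ≤ σ i) :
    open Literature.MathematicalPhysics.QuantumFieldTheory.Balaban1983to89 Literature.MathematicalPhysics.QuantumFieldTheory.Balaban1983to89.T3ContinuumYM3Torus in ∀ (L : ℕ), ∃ T : ℝ, 0 < T ∧ ∃ CS : ℝ, 0 ≤ CS ∧ ∀ (b₀ p₀ : ℝ), 0 < b₀ → 2 < p₀ → ∃ γ₁ : ℝ, 0 < γ₁ ∧ γ₁ ≤ 1 ∧ ∀ (F : T3Family) (γ : ℝ), F.L = L → 0 < γ → γ ≤ γ₁ → ∀ (K j : ℕ), 1 ≤ j → j + 3 ≤ K → ∀ (a : Plaq (F.P K) (j + 1)) (U U' : GaugeField (F.P K) 0 (Matrix.specialUnitaryGroup (Fin 2) ℂ)), (∀ (i : ℕ) (q : Plaq (F.P K) i), i < j + 1 → Site.tdist (fun k => ((((q.src k).val * F.L ^ i : ℕ)) : ZMod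 ((F.P K).sitesPerDir 0))) (fun k => ((((a.src k).val * F.L ^ (j + 1) : ℕ)) : ZMod ((F.P K).sitesPerDir 0))) + 64 * F.L ^ i ≤ 64 * F.L ^ (j + 1) → GaugeGroup.dist1 (GaugeField.plaqHol (Averaging.iter (fun i' => BlockAveraging.blockAvg (P := F.P K) (j := i') T3UnitLawDensityEML.ℰp) i U) q) < T3UnitScaleTilt.θBal F.L γ b₀ p₀ (K - i)) → (∀ (i : ℕ) (q : Plaq (F.P K) i), i < j + 1 → Site.tdist (fun k => ((((q.src k).val * F.L ^ i : ℕ)) : ZMod ((F.P K).sitesPerDir 0))) (fun k => ((((a.src k).val * F.L ^ (j + 1) : ℕ)) : ZMod ((F.P K).sitesPerDir 0))) + 64 * F.L ^ i ≤ 64 * F.L ^ (j + 1) → GaugeGroup.dist1 (GaugeField.plaqHol (Averaging.iter (fun i' => BlockAveraging.blockAvg (P := F.P K) (j := i') T3UnitLawDensityEML.ℰp) i U') q) < T3UnitScaleTilt.θBal F.L γ b₀ p₀ (K - i)) → (∀ k : GaugeTransf (F.P K) 0 (Matrix.specialUnitaryGroup (Fin 2) ℂ), (∑ b : PBond (F.P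 K) 0, if (∀ k, (b.src k - ((((a.src k).val * F.L ^ (j + 1) : ℕ)) : ZMod ((F.P K).sitesPerDir 0)) + ((8 * F.L ^ (j + 1) : ℕ) : ZMod ((F.P K).sitesPerDir 0))).val < 17 * F.L ^ (j + 1)) ∧ (∀ k, (b.tgt k - ((((a.src k).val * F.L ^ (j + 1) : ℕ)) : ZMod ((F.P K).sitesPerDir 0)) + ((8 * F.L ^ (j + 1) : ℕ) : ZMod ((F.P K).sitesPerDir 0))).val < 17 * F.L ^ (j + 1)) then GaugeGroup.dist1 (U b * (U' b)⁻¹) ^ 2 else 0) ≤ (∑ b : PBond (F.P K) 0, if (∀ k, (b.src k - ((((a.src k).val * F.L ^ (j + 1) : ℕ)) : ZMod ((F.P K).sitesPerDir 0)) + ((8 * F.L ^ (j + 1) : ℕ) : ZMod ((F.P K).sitesPerDir 0))).val < 17 * F.L ^ (j + 1)) ∧ (∀ k, (b.tgt k - ((((a.src k).val * F.L ^ (j + 1) : ℕ)) : ZMod ((F.P K).sitesPerDir 0)) + ((8 * F.L ^ (j + 1) : ℕ) : ZMod ((F.P K).sitesPerDir 0))).val < 17 * F.L ^ (j + 1)) then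 GaugeGroup.dist1 (U b * (GaugeField.gaugeAct k U' b)⁻¹) ^ 2 else 0)) → Real.sqrt (∑ b : PBond (F.P K) 0, if (∀ k, (b.src k - ((((a.src k).val * F.L ^ (j + 1) : ℕ)) : ZMod ((F.P K).sitesPerDir 0)) + ((8 * F.L ^ (j + 1) : ℕ) : ZMod ((F.P K).sitesPerDir 0))).val < 17 * F.L ^ (j + 1)) ∧ (∀ k, (b.tgt k - ((((a.src k).val * F.L ^ (j + 1) : ℕ)) : ZMod ((F.P K).sitesPerDir 0)) + ((8 * F.L ^ (j + 1) : ℕ) : ZMod ((F.P K).sitesPerDir 0))).val < 17 * F.L ^ (j + 1)) then GaugeGroup.dist1 (U b * (U' b)⁻¹) ^ 2 else 0) ≤ T * Real.sqrt ((F.L : ℝ) ^ (j + 1)) * T3UnitScaleTilt.θBal F.L γ b₀ p₀ (K - j) → ∃ h : GaugeTransf (F.P K) j (Matrix.specialUnitaryGroup (Fin 2) ℂ), ∀ c : PBond (F.P K) (j + 1), (c = ⟨a.src, a.μ⟩ ∨ c = ⟨a.src.shift a.μ, a.ν⟩ ∨ c = ⟨a.src.shift a.ν, a.μ⟩ ∨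 c = ⟨a.src, a.ν⟩) → ∀ b : PBond (F.P K) j, (blockOf b.src = c.src ∨ blockOf b.src = c.tgt) → (blockOf b.tgt = c.src ∨ blockOf b.tgt = c.tgt) → GaugeGroup.dist1 (Averaging.iter (fun i' => BlockAveraging.blockAvg (P := F.P K) (j := i') T3UnitLawDensityEML.ℰp) j U b * (GaugeField.gaugeAct h (Averaging.iter (fun i' => BlockAveraging.blockAvg (P := F.P K) (j := i') T3UnitLawDensityEML.ℰp) j U') b)⁻¹) ≤ CS / Real.sqrt ((F.L : ℝ) ^ (j + 1)) * Real.sqrt (∑ b : PBond (F.P K) 0, if (∀ k, (b.src k - ((((a.src k).val * F.L ^ (j + 1) : ℕ)) : ZMod ((F.P K).sitesPerDir 0)) + ((8 * F.L ^ (j + 1) : ℕ) : ZMod ((F.P K).sitesPerDir 0))).val < 17 * F.L ^ (j + 1)) ∧ (∀ k, (b.tgt k - ((((a.src k).val * F.L ^ (j + 1) : ℕ)) : ZMod ((F.P K).sitesPerDir 0)) + ((8 * F.L ^ (j + 1) : ℕ) : ZMod ((F.P K).sitesPerDir 0))).val < 17 * F.L ^ (j + 1)) then GaugeGroup.dist1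 (U b * (U' b)⁻¹) ^ 2 else 0) :=
  avgStability_star_of_charts (charts_of_lowCharts hLow)

/-- ★★★ **`stub_iteratedLipschitz` FROM THE LOW-LEVEL CHARTS** (§2 ∘ ✓`stub_iteratedLipschitz_of_charts`): the registered `j ≥ 2` stub of line `poincare_lipschitz`
holds VERBATIM once per-bond charts at the per-level minimisers are supplied AT THE LOW LEVELS ONLY (`((10⁸L⁷)⁻¹)²(4∕9)^i < 4L^{−i}·Bx`); in particular with NO
hypothesis beyond the windows for every pair with `2√Bx ≤ (10⁸L⁷)⁻¹`. [cite: Balaban1987RG1, (0.4) p.253] -/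
theorem stub_iteratedLipschitz_of_lowCharts
    (hLow : open Literature.MathematicalPhysics.QuantumFieldTheory.Balaban1983to89 Literature.MathematicalPhysics.QuantumFieldTheory.Balaban1983to89.T3ContinuumYM3Torus in ∀ (L : ℕ), ∃ T : ℝ, 0 < T ∧ ∀ (b₀ p₀ : ℝ), 0 < b₀ → 2 < p₀ → ∃ γ₂ : ℝ, 0 < γ₂ ∧ ∀ (F : T3Family) (γ : ℝ), F.L = L → 0 < γ → γ ≤ γ₂ → ∀ (K j : ℕ), 1 ≤ j → j + 3 ≤ K → ∀ (a : Plaq (F.P K) (j + 1)) (U U' : GaugeField (F.P K) 0 (Matrix.specialUnitaryGroup (Fin 2) ℂ)), (∀ (i : ℕ) (q : Plaq (F.P K) i), i < j + 1 → Site.tdist (fun k => ((((q.src k).val * F.L ^ i : ℕ)) : ZMod ((F.P K).sitesPerDir 0))) (fun k => ((((a.src k).val * F.L ^ (j + 1) : ℕ)) : ZMod ((F.P K).sitesPerDir 0))) + 64 * F.L ^ i ≤ 64 * F.L ^ (j + 1) → GaugeGroup.dist1 (GaugeField.plaqHol (Averaging.iter (fun i' => BlockAveraging.blockAvg (P :=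 F.P K) (j := i') T3UnitLawDensityEML.ℰp) i U) q) < T3UnitScaleTilt.θBal F.L γ b₀ p₀ (K - i)) → (∀ (i : ℕ) (q : Plaq (F.P K) i), i < j + 1 → Site.tdist (fun k => ((((q.src k).val * F.L ^ i : ℕ)) : ZMod ((F.P K).sitesPerDir 0))) (fun k => ((((a.src k).val * F.L ^ (j + 1) : ℕ)) : ZMod ((F.P K).sitesPerDir 0))) + 64 * F.L ^ i ≤ 64 * F.L ^ (j + 1) → GaugeGroup.dist1 (GaugeField.plaqHol (Averaging.iter (fun i' => BlockAveraging.blockAvg (P := F.P K) (j := i') T3UnitLawDensityEML.ℰp) i U') q) < T3UnitScaleTilt.θBal F.L γ b₀ p₀ (K - i)) → (∀ k : GaugeTransf (F.P K) 0 (Matrix.specialUnitaryGroup (Fin 2) ℂ), (∑ b : PBond (F.P K) 0, if (∀ k, (b.src k - ((((a.src k).val * F.L ^ (j + 1) : ℕ)) : ZMod ((F.P K).sitesPerDir 0)) + ((8 * F.L ^ (j + 1) : ℕ) : ZMod ((F.P K).sitesPerDir 0))).val < 17 * F.L ^ (j + 1)) ∧ (∀ k, (b.tgt k - ((((a.src k).val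 * F.L ^ (j + 1) : ℕ)) : ZMod ((F.P K).sitesPerDir 0)) + ((8 * F.L ^ (j + 1) : ℕ) : ZMod ((F.P K).sitesPerDir 0))).val < 17 * F.L ^ (j + 1)) then GaugeGroup.dist1 (U b * (U' b)⁻¹) ^ 2 else 0) ≤ (∑ b : PBond (F.P K) 0, if (∀ k, (b.src k - ((((a.src k).val * F.L ^ (j + 1) : ℕ)) : ZMod ((F.P K).sitesPerDir 0)) + ((8 * F.L ^ (j + 1) : ℕ) : ZMod ((F.P K).sitesPerDir 0))).val < 17 * F.L ^ (j + 1)) ∧ (∀ k, (b.tgt k - ((((a.src k).val * F.L ^ (j + 1) : ℕ)) : ZMod ((F.P K).sitesPerDir 0)) + ((8 * F.L ^ (j + 1) : ℕ) : ZMod ((F.P K).sitesPerDir 0))).val < 17 * F.L ^ (j + 1)) then GaugeGroup.dist1 (U b * (GaugeField.gaugeAct k U' b)⁻¹) ^ 2 else 0)) → Real.sqrt (∑ b : PBond (F.P K) 0, if (∀ k, (b.src k - ((((a.src k).val * F.L ^ (j + 1) : ℕ)) : ZMod ((F.P K).sitesPerDir 0)) + ((8 * F.L ^ (j + 1) : ℕ)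 : ZMod ((F.P K).sitesPerDir 0))).val < 17 * F.L ^ (j + 1)) ∧ (∀ k, (b.tgt k - ((((a.src k).val * F.L ^ (j + 1) : ℕ)) : ZMod ((F.P K).sitesPerDir 0)) + ((8 * F.L ^ (j + 1) : ℕ) : ZMod ((F.P K).sitesPerDir 0))).val < 17 * F.L ^ (j + 1)) then GaugeGroup.dist1 (U b * (U' b)⁻¹) ^ 2 else 0) ≤ T * Real.sqrt ((F.L : ℝ) ^ (j + 1)) * T3UnitScaleTilt.θBal F.L γ b₀ p₀ (K - j) → ∃ m : ℕ → ℕ, (∀ i, m i ≤ m (i + 1)) ∧ m j ≤ F.L ^ (j + 1) ∧ ∃ σ : ℕ → ℝ, (∀ i, i < j → 0 ≤ σ i ∧ σ i ≤ 1 / (2 * 10 ^ 7 * (L : ℝ) ^ 4)) ∧ (∑ i ∈ Finset.range j, σ i ≤ 1 / (2 * 10 ^ 7 * (L : ℝ) ^ 7)) ∧ ∀ i, i < j → ∀ h : GaugeTransf (F.P K) i (Matrix.specialUnitaryGroup (Fin 2) ℂ), (∀ k' : GaugeTransf (F.P K) i (Matrix.specialUnitaryGroup (Fin 2) ℂ),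 (∑ b : PBond (F.P K) i, if b ∈ Finset.univ.filter (fun b : PBond (F.P K) i => Site.tdist (fun k => ((((b.src k).val * F.L ^ i : ℕ)) : ZMod ((F.P K).sitesPerDir 0))) (fun k => ((((a.src k).val * F.L ^ (j + 1) : ℕ)) : ZMod ((F.P K).sitesPerDir 0))) + 2 * F.L ^ (i + 1) + m i ≤ 8 * F.L ^ (j + 1)) then GaugeGroup.dist1 (Averaging.iter (fun i' => BlockAveraging.blockAvg (P := F.P K) (j := i') T3UnitLawDensityEML.ℰp) i U b * (GaugeField.gaugeAct h (Averaging.iter (fun i' => BlockAveraging.blockAvg (P := F.P K) (j := i') T3UnitLawDensityEML.ℰp) i U') b)⁻¹) ^ 2 else 0) ≤ ∑ b : PBond (F.P K) i, if b ∈ Finset.univ.filter (fun b : PBond (F.P K) i => Site.tdist (fun k => ((((b.src k).val * F.L ^ i : ℕ)) : ZMod ((F.P K).sitesPerDir 0))) (fun k => ((((a.src k).val * F.L ^ (j + 1) : ℕ)) : ZMod ((F.P K).sitesPerDir 0))) + 2 * F.L ^ (i + 1) + m i ≤ 8 * F.L ^ (j + 1)) then GaugeGroup.dist1 (Averaging.iter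 (fun i' => BlockAveraging.blockAvg (P := F.P K) (j := i') T3UnitLawDensityEML.ℰp) i U b * (GaugeField.gaugeAct k' (GaugeField.gaugeAct h (Averaging.iter (fun i' => BlockAveraging.blockAvg (P := F.P K) (j := i') T3UnitLawDensityEML.ℰp) i U')) b)⁻¹) ^ 2 else 0) → ∑ b ∈ Finset.univ.filter (fun b : PBond (F.P K) i => Site.tdist (fun k => ((((b.src k).val * F.L ^ i : ℕ)) : ZMod ((F.P K).sitesPerDir 0))) (fun k => ((((a.src k).val * F.L ^ (j + 1) : ℕ)) : ZMod ((F.P K).sitesPerDir 0))) + 2 * F.L ^ (i + 1) + m i ≤ 8 * F.L ^ (j + 1)), ‖BlockAveragingEMLLinearisedBackground.pertVar (Averaging.iter (fun i' => BlockAveraging.blockAvg (P := F.P K) (j := i') T3UnitLawDensityEML.ℰp) i U) (GaugeField.gaugeAct h (Averaging.iter (fun i' => BlockAveraging.blockAvg (P := F.P K) (j := i') T3UnitLawDensityEML.ℰp) i U')) b‖ ^ 2 ≤ 4 * ((F.L : ℝ) ^ i)⁻¹ * (∑ b : PBond (F.P K) 0, if (∀ k, (b.src k - ((((a.src k).val *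 F.L ^ (j + 1) : ℕ)) : ZMod ((F.P K).sitesPerDir 0)) + ((8 * F.L ^ (j + 1) : ℕ) : ZMod ((F.P K).sitesPerDir 0))).val < 17 * F.L ^ (j + 1)) ∧ (∀ k, (b.tgt k - ((((a.src k).val * F.L ^ (j + 1) : ℕ)) : ZMod ((F.P K).sitesPerDir 0)) + ((8 * F.L ^ (j + 1) : ℕ) : ZMod ((F.P K).sitesPerDir 0))).val < 17 * F.L ^ (j + 1)) then GaugeGroup.dist1 (U b * (U' b)⁻¹) ^ 2 else 0) → (1 / (10 ^ 8 * (L : ℝ) ^ 7)) ^ 2 * (4 / 9) ^ i < 4 * ((F.L : ℝ) ^ i)⁻¹ * (∑ b : PBond (F.P K) 0, if (∀ k, (b.src k - ((((a.src k).val * F.L ^ (j + 1) : ℕ)) : ZMod ((F.P K).sitesPerDir 0)) + ((8 * F.L ^ (j + 1) : ℕ) : ZMod ((F.P K).sitesPerDir 0))).val < 17 * F.L ^ (j + 1)) ∧ (∀ k, (b.tgt k - ((((a.src k).val * F.L ^ (j + 1) : ℕ)) : ZMod ((F.P K).sitesPerDir 0)) + ((8 * F.L ^ (j + 1) : ℕ)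 : ZMod ((F.P K).sitesPerDir 0))).val < 17 * F.L ^ (j + 1)) then GaugeGroup.dist1 (U b * (U' b)⁻¹) ^ 2 else 0) → ∀ c ∈ Finset.univ.filter (fun b : PBond (F.P K) (i + 1) => Site.tdist (fun k => ((((b.src k).val * F.L ^ (i + 1) : ℕ)) : ZMod ((F.P K).sitesPerDir 0))) (fun k => ((((a.src k).val * F.L ^ (j + 1) : ℕ)) : ZMod ((F.P K).sitesPerDir 0))) + 2 * F.L ^ (i + 1 + 1) + m (i + 1) ≤ 8 * F.L ^ (j + 1)), ∀ b ∈ Finset.univ.filter (fun b : PBond (F.P K) i => blockOf b.src = c.src ∨ blockOf b.src = c.tgt), ‖BlockAveragingEMLLinearisedBackground.pertVar (Averaging.iter (fun i' => BlockAveraging.blockAvg (P := F.P K) (j := i') T3UnitLawDensityEML.ℰp) i U) (GaugeField.gaugeAct h (Averaging.iter (fun i' => BlockAveraging.blockAvg (P := F.P K) (j := i') T3UnitLawDensityEML.ℰp) i U')) b‖ ≤ σ i) :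
    open Literature.MathematicalPhysics.QuantumFieldTheory.Balaban1983to89 Literature.MathematicalPhysics.QuantumFieldTheory.Balaban1983to89.T3ContinuumYM3Torus in ∀ (L : ℕ), ∃ CL : ℝ, 0 ≤ CL ∧ ∀ (b₀ p₀ : ℝ), 0 < b₀ → 2 < p₀ → ∃ γ₁ : ℝ, 0 < γ₁ ∧ γ₁ ≤ 1 ∧ ∀ (F : T3Family) (γ : ℝ), F.L = L → 0 < γ → γ ≤ γ₁ → ∀ (K j : ℕ), 1 ≤ j → j + 2 ≤ K → 2 ≤ j → ∀ (a : Plaq (F.P K) j) (U U' : GaugeField (F.P K) 0 (Matrix.specialUnitaryGroup (Fin 2) ℂ)), (∀ (i : ℕ) (q : Plaq (F.P K) i), i < j → Site.tdist (fun k => ((((q.src k).val * F.L ^ i : ℕ)) : ZMod ((F.P K).sitesPerDir 0))) (fun k => ((((a.src k).val * F.L ^ j : ℕ)) : ZMod ((F.P K).sitesPerDir 0))) + 64 * F.L ^ i ≤ 64 * F.L ^ j → GaugeGroup.dist1 (GaugeField.plaqHol (Averaging.iter (fun i' => BlockAveraging.blockAvg (P := F.P K) (j := i') T3UnitLawDensityEML.ℰp)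 i U) q) < T3UnitScaleTilt.θBal F.L γ b₀ p₀ (K - i)) → (∀ (i : ℕ) (q : Plaq (F.P K) i), i < j → Site.tdist (fun k => ((((q.src k).val * F.L ^ i : ℕ)) : ZMod ((F.P K).sitesPerDir 0))) (fun k => ((((a.src k).val * F.L ^ j : ℕ)) : ZMod ((F.P K).sitesPerDir 0))) + 64 * F.L ^ i ≤ 64 * F.L ^ j → GaugeGroup.dist1 (GaugeField.plaqHol (Averaging.iter (fun i' => BlockAveraging.blockAvg (P := F.P K) (j := i') T3UnitLawDensityEML.ℰp) i U') q) < T3UnitScaleTilt.θBal F.L γ b₀ p₀ (K - i)) → |GaugeGroup.dist1 (GaugeField.plaqHol (Averaging.iter (fun i' => BlockAveraging.blockAvg (P := F.P K) (j := i') T3UnitLawDensityEML.ℰp) j U) a) - GaugeGroup.dist1 (GaugeField.plaqHol (Averaging.iter (fun i' => BlockAveraging.blockAvg (P := F.P K) (j := i') T3UnitLawDensityEML.ℰp) j U') a)| ≤ CL / Real.sqrt ((F.L : ℝ) ^ j) * Real.sqrt (∑ b : PBond (F.P K) 0, if (∀ k, (b.src k - ((((a.src k).val * F.L ^ j : ℕ))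 : ZMod ((F.P K).sitesPerDir 0)) + ((8 * F.L ^ j : ℕ) : ZMod ((F.P K).sitesPerDir 0))).val < 17 * F.L ^ j) ∧ (∀ k, (b.tgt k - ((((a.src k).val * F.L ^ j : ℕ)) : ZMod ((F.P K).sitesPerDir 0)) + ((8 * F.L ^ j : ℕ) : ZMod ((F.P K).sitesPerDir 0))).val < 17 * F.L ^ j) then GaugeGroup.dist1 (U b * (U' b)⁻¹) ^ 2 else 0) :=
  stub_iteratedLipschitz_of_charts (charts_of_lowCharts hLow)

end Summit.QuantumFields.YangMills.Theorems.PoincareLipschitzMassRowsOfLowCharts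

end
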